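/- Width seat `ym-line-sfw-p2-w5` (prover-ym-line-sfw-p2-w5-g18-0), free hands on planner ym-idea-2 g16's LINE-19 task board (STUB-PLAN-S4b §11):
the Caccioppoli cutoff for the Hodge column and the per-functional commutator bound with the zone indicator. -/
import Summits.QuantumFields.YangMills.Theorems.AllWindowsColdBoxBoxHighLineCaccioppoliIdentity
import Summits.QuantumFields.YangMills.Theorems.AllWindowsColdBoxBoxHighLineHodgeSupports

/-!
# LINE-19 S4b §11: the Caccioppoli cutoff `χ = clamp((ℓ¹ − (r+1))/(r−2), 0, 1)` and the zone bound for one local functional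

Preparation for the discrete Caccioppoli inequality of the Hodge column (`…BoxHighLineCaccioppoliThree`):

* `edgeDist` (ℓ¹ base-point distance of free edges), `cutoff e r` and its properties for `r ≥ 3`: `cutoff_self` (`χ e = 0`),
  `cutoff_eq_zero_of_le` (`χ = 0` on `d ≤ r+1`), `cutoff_eq_one_of_ge` (`χ = 1` on `d ≥ 2r−1`), `abs_cutoff_sub_le`
  (`|χ_i − χ_j| ≤ |d_i − d_j|/(r−2)`, `clamp` being 1-Lipschitz);
* support sizes `card_support_landauCoeff_le` (`≤ 4`) and `card_support_gradVec_le` (`≤ 8`);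
* **`abs_commutator_cutoff_le_zone`**: for a local functional with `|a| ≤ A`, support size `≤ N` and ℓ¹-diameter `≤ 2`, the commutator
  double sum against `χ` is `≤ (2/(r−2))²·A²·N·Σ_{i ∈ supp a, r ≤ d ≤ 2r} u_i²` — it vanishes unless the support lies in the zone `r ≤ d ≤ 2r`
  (✓`abs_commutator_sum_le`).

Everything proved; two bookkeeping definitions (`edgeDist`, `cutoff`); standard axioms.  HONEST LABEL: helpers toward ONE registered stub (S4b) of
a critic-PASSed line on the R2ξ″ RECORD-rung crux 24004 / 24335; no stub is proved by name, no crux, rung or summit is proved; the Yang–Mills mass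
gap is NOT proved by this file.
-/

set_option autoImplicit false

noncomputable section

open Finset Matrix
open Literature.MathematicalPhysics.QuantumFieldTheory
open Literature.MathematicalPhysics.QuantumFieldTheory.LatticeMaxwell
open Literature.MathematicalPhysics.QuantumFieldTheory.AxialGauge
open Summit.QuantumFields.YangMills.Theorems.WeakCouplingRates
open Summit.QuantumFields.YangMills.Theorems.AllWindowsColdBox
open Literature.Probability.LatticeModels (Site)

namespace Summit.QuantumFields.YangMills.Theorems.AllWindowsColdBoxBoxHighLine

/-! ## The ℓ¹ edge distance and the cutoff -/

/-- ℓ¹ distance between the base points of two free edges. -/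
def edgeDist {H : ℕ} (e i : LandauFree H) : ℤ := ∑ m : Fin 4, |e.1.1.1 m - i.1.1.1 m|

/-- The edge distance is nonnegative. -/
theorem edgeDist_nonneg {H : ℕ} (e i : LandauFree H) : 0 ≤ edgeDist e i :=
  Finset.sum_nonneg fun _ _ => abs_nonneg _

/-- `edgeDist e e = 0`. -/
theorem edgeDist_self {H : ℕ} (e : LandauFree H) : edgeDist e e = 0 := by simp [edgeDist]

/-- The Caccioppoli cutoff at radius `r`: `clamp((d(e,i) − (r+1))/(r−2), 0, 1)`. -/
def cutoff {H : ℕ} (e : LandauFree H) (r : ℕ) (i : LandauFree H) : ℝ :=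
  max 0 (min 1 (((edgeDist e i : ℝ) - ((r : ℝ) + 1)) / ((r : ℝ) - 2)))

/-- The cutoff vanishes at the centre. -/
theorem cutoff_self {H : ℕ} (e : LandauFree H) {r : ℕ} (hr : 3 ≤ r) : cutoff e r e = 0 := by
  unfold cutoff
  rw [edgeDist_self]
  have hr' : (3 : ℝ) ≤ r := by exact_mod_cast hr
  have hneg : (((0 : ℤ) : ℝ) - ((r : ℝ) + 1)) / ((r : ℝ) - 2) ≤ 0 :=
    div_nonpos_of_nonpos_of_nonneg (by push_cast; linarith) (by linarith)
  rw [min_eq_right (by linarith), max_eq_left hneg]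

/-- The cutoff vanishes on `d ≤ r + 1`. -/
theorem cutoff_eq_zero_of_le {H : ℕ} (e : LandauFree H) {r : ℕ} (hr : 3 ≤ r) {i : LandauFree H}
    (hi : edgeDist e i ≤ (r : ℤ) + 1) : cutoff e r i = 0 := by
  unfold cutoff
  have hr' : (3 : ℝ) ≤ r := by exact_mod_cast hr
  have hi' : (edgeDist e i : ℝ) ≤ (r : ℝ) + 1 := by exact_mod_cast hi
  have hneg : ((edgeDist e i : ℝ) - ((r : ℝ) + 1)) / ((r : ℝ) - 2) ≤ 0 :=
    div_nonpos_of_nonpos_of_nonneg (by linarith) (by linarith)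
  rw [min_eq_right (by linarith), max_eq_left hneg]

/-- The cutoff equals `1` on `d ≥ 2r − 1`. -/
theorem cutoff_eq_one_of_ge {H : ℕ} (e : LandauFree H) {r : ℕ} (hr : 3 ≤ r) {i : LandauFree H}
    (hi : 2 * (r : ℤ) - 1 ≤ edgeDist e i) : cutoff e r i = 1 := by
  unfold cutoff
  have hr' : (3 : ℝ) ≤ r := by exact_mod_cast hr
  have hi' : 2 * (r : ℝ) - 1 ≤ (edgeDist e i : ℝ) := by exact_mod_cast hi
  have hone : 1 ≤ ((edgeDist e i : ℝ) - ((r : ℝ) + 1)) / ((r : ℝ) - 2) := by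
    rw [le_div_iff₀ (by linarith)]
    linarith
  rw [min_eq_left hone, max_eq_right zero_le_one]

/-- **Lipschitz property of the cutoff**: `|χ_i − χ_j| ≤ |d_i − d_j|/(r−2)`. -/
theorem abs_cutoff_sub_le {H : ℕ} (e : LandauFree H) {r : ℕ} (hr : 3 ≤ r) (i j : LandauFree H) :
    |cutoff e r i - cutoff e r j| ≤ |((edgeDist e i : ℝ)) - (edgeDist e j : ℝ)| / ((r : ℝ) - 2) := by
  unfold cutoff
  have hr' : (3 : ℝ) ≤ r := by exact_mod_cast hr
  have hw : (0 : ℝ) < (r : ℝ) - 2 := by linarith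
  -- `clamp` is 1-Lipschitz (tree: `Literature.NumberTheory.LFunctions.PlateauMollifier.abs_clamp_sub_clamp_le`; inlined to keep imports light)
  have hclamp : ∀ s t : ℝ, |max 0 (min 1 s) - max 0 (min 1 t)| ≤ |s - t| := by
    intro s t
    have h1 : |max 0 (min 1 s) - max 0 (min 1 t)| ≤ max |(0 : ℝ) - 0| |min 1 s - min 1 t| := abs_max_sub_max_le_max _ _ _ _
    have h2 : |min 1 s - min 1 t| ≤ max |(1 : ℝ) - 1| |s - t| := abs_min_sub_min_le_max _ _ _ _
    have e1 : max |(0 : ℝ) - 0| |min 1 s - min 1 t| = |min 1 s - min 1 t| := by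
      rw [sub_self, abs_zero]; exact max_eq_right (abs_nonneg _)
    have e2 : max |(1 : ℝ) - 1| |s - t| = |s - t| := by
      rw [sub_self, abs_zero]; exact max_eq_right (abs_nonneg _)
    rw [e1] at h1
    rw [e2] at h2
    exact h1.trans h2
  refine (hclamp _ _).trans ?_
  rw [← sub_div, abs_div, abs_of_pos hw]
  refine div_le_div_of_nonneg_right (le_of_eq ?_) hw.le
  congr 1
  ring

/-! ## Support sizes -/

/-- The support of `λ_p` has at most `4` free edges. -/
theorem card_support_landauCoeff_le {H : ℕ} (p : Plaq 4) :
    #((Finset.univ : Finset (LandauFree H)).filter (fun i => landauCoeff H p i ≠ 0)) ≤ 4 := by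
  classical
  set E4 : Finset (Literature.MathematicalPhysics.QuantumLattice.ZdEdge 4) :=
    {(p.1, p.2.1), (p.1 + Pi.single p.2.1 1, p.2.2), (p.1 + Pi.single p.2.2 1, p.2.1), (p.1, p.2.2)} with hE4
  have hmaps : Set.MapsTo (fun i : LandauFree H => i.1.1)
      ((Finset.univ : Finset (LandauFree H)).filter (fun i => landauCoeff H p i ≠ 0) : Set (LandauFree H))
      (E4 : Set (Literature.MathematicalPhysics.QuantumLattice.ZdEdge 4)) := by
    intro i hi
    have hne := (Finset.mem_filter.1 (Finset.mem_coe.1 hi)).2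
    unfold landauCoeff LatticeMaxwell.coeff at hne
    rw [Finset.mem_coe]
    by_contra hnot
    apply hne
    apply LatticeMaxwell.coeffAux_eq_zero
    simp only [hE4, Finset.mem_insert, Finset.mem_singleton, not_or] at hnot
    obtain ⟨h1, h2, h3, h4⟩ := hnot
    push Not
    exact ⟨Ne.symm h1, Ne.symm h2, Ne.symm h3, Ne.symm h4⟩
  have hinj : Set.InjOn (fun i : LandauFree H => i.1.1)
      ((Finset.univ : Finset (LandauFree H)).filter (fun i => landauCoeff H p i ≠ 0) : Set (LandauFree H)) :=
    fun i _ j _ h => Subtype.ext (Subtype.ext h)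
  calc #((Finset.univ : Finset (LandauFree H)).filter (fun i => landauCoeff H p i ≠ 0)) ≤ #E4 :=
        Finset.card_le_card_of_injOn _ hmaps hinj
    _ ≤ 4 := by rw [hE4]; exact Finset.card_le_four

/-- The support of `g_x` has at most `8` free edges. -/
theorem card_support_gradVec_le {H : ℕ} (x : Site 4) :
    #((Finset.univ : Finset (LandauFree H)).filter (fun i => gradVec H x i ≠ 0)) ≤ 8 := by
  classical
  set E8 : Finset (Literature.MathematicalPhysics.QuantumLattice.ZdEdge 4) :=
    (Finset.univ : Finset (Fin 4)).image (fun μ => (x, μ)) ∪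
      (Finset.univ : Finset (Fin 4)).image (fun μ => (x - Pi.single μ 1, μ)) with hE8
  have hmaps : Set.MapsTo (fun i : LandauFree H => i.1.1)
      ((Finset.univ : Finset (LandauFree H)).filter (fun i => gradVec H x i ≠ 0) : Set (LandauFree H))
      (E8 : Set (Literature.MathematicalPhysics.QuantumLattice.ZdEdge 4)) := by
    intro i hi
    have hne := (Finset.mem_filter.1 (Finset.mem_coe.1 hi)).2
    unfold gradVec at hne
    rw [Finset.mem_coe, hE8, Finset.mem_union, Finset.mem_image, Finset.mem_image]
    by_cases h1 : i.1.1.1 + Pi.single i.1.1.2 1 = x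
    · right
      refine ⟨i.1.1.2, Finset.mem_univ _, ?_⟩
      rw [← h1]
      ext <;> simp
    · by_cases h2 : i.1.1.1 = x
      · left
        refine ⟨i.1.1.2, Finset.mem_univ _, ?_⟩
        rw [← h2]
      · exfalso; apply hne; rw [if_neg h1, if_neg h2]; ring
  have hinj : Set.InjOn (fun i : LandauFree H => i.1.1)
      ((Finset.univ : Finset (LandauFree H)).filter (fun i => gradVec H x i ≠ 0) : Set (LandauFree H)) :=
    fun i _ j _ h => Subtype.ext (Subtype.ext h)
  calc #((Finset.univ : Finset (LandauFree H)).filter (fun i => gradVec H x i ≠ 0)) ≤ #E8 :=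
        Finset.card_le_card_of_injOn _ hmaps hinj
    _ ≤ 8 := by
        rw [hE8]
        refine (Finset.card_union_le _ _).trans ?_
        have h1 := Finset.card_image_le (s := (Finset.univ : Finset (Fin 4))) (f := fun μ => (x, μ))
        have h2 := Finset.card_image_le (s := (Finset.univ : Finset (Fin 4))) (f := fun μ => (x - Pi.single μ 1, μ))
        rw [Finset.card_univ, Fintype.card_fin] at h1 h2
        omega

/-! ## The commutator of one local functional against the cutoff -/
set_option maxHeartbeats 400000 in
/-- **Per-functional commutator bound with the zone indicator.**  For a local functional `a` with `|a| ≤ A`, support of size `≤ N` and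
ℓ¹-diameter `≤ 2`, and the cutoff `χ = cutoff e r` (`r ≥ 3`): the commutator double sum is bounded by
`(2/(r−2))²·A²·N·Σ_{i ∈ supp a, r ≤ d(e,i) ≤ 2r} u_i²` — it vanishes unless the support lies in the zone `r ≤ d ≤ 2r`. -/
theorem abs_commutator_cutoff_le_zone {H : ℕ} (e : LandauFree H) {r : ℕ} (hr : 3 ≤ r) (a u : LandauFree H → ℝ) {A : ℝ} {N : ℕ}
    (hA : 0 ≤ A) (habs : ∀ i, |a i| ≤ A) (hcard : #((Finset.univ : Finset (LandauFree H)).filter (fun i => a i ≠ 0)) ≤ N)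
    (hdiam : ∀ i j, a i ≠ 0 → a j ≠ 0 → |(edgeDist e i : ℝ) - (edgeDist e j : ℝ)| ≤ 2) :
    |∑ i, ∑ j, a i * a j * (u i * u j) * (cutoff e r i - cutoff e r j) ^ 2| ≤
      (2 / ((r : ℝ) - 2)) ^ 2 * A ^ 2 * N *
        ∑ i ∈ (Finset.univ : Finset (LandauFree H)).filter (fun i => a i ≠ 0),
          (if (r : ℤ) ≤ edgeDist e i ∧ edgeDist e i ≤ 2 * (r : ℤ) then u i ^ 2 else 0) := by
  have hr' : (3 : ℝ) ≤ r := by exact_mod_cast hr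
  have hw : (0 : ℝ) < (r : ℝ) - 2 := by linarith
  have hmemS : ∀ i, i ∈ ((Finset.univ : Finset (LandauFree H)).filter (fun i => a i ≠ 0)) ↔ a i ≠ 0 := fun i => by
    rw [Finset.mem_filter]; exact ⟨fun h => h.2, fun h => ⟨Finset.mem_univ _, h⟩⟩
  have hsupp : ∀ i, i ∉ ((Finset.univ : Finset (LandauFree H)).filter (fun i => a i ≠ 0)) → a i = 0 := fun i hi => by
    rw [hmemS] at hi; push Not at hi; exact hi
  have hind0 : 0 ≤ ∑ i ∈ ((Finset.univ : Finset (LandauFree H)).filter (fun i => a i ≠ 0)), (if (r : ℤ) ≤ edgeDist e i ∧ edgeDist e i ≤ 2 * (r : ℤ) then u i ^ 2 else 0) :=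
    Finset.sum_nonneg fun i _ => by split_ifs <;> positivity
  have hK0 : 0 ≤ (2 / ((r : ℝ) - 2)) ^ 2 * A ^ 2 * N :=
    mul_nonneg (mul_nonneg (sq_nonneg _) (sq_nonneg _)) (Nat.cast_nonneg _)
  have hRHS0 : 0 ≤ (2 / ((r : ℝ) - 2)) ^ 2 * A ^ 2 * N * ∑ i ∈ ((Finset.univ : Finset (LandauFree H)).filter (fun i => a i ≠ 0)), (if (r : ℤ) ≤ edgeDist e i ∧ edgeDist e i ≤ 2 * (r : ℤ) then u i ^ 2 else 0) := mul_nonneg hK0 hind0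
  by_cases hC : (∃ i ∈ ((Finset.univ : Finset (LandauFree H)).filter (fun i => a i ≠ 0)), (r : ℤ) + 1 < edgeDist e i) ∧ (∃ j ∈ ((Finset.univ : Finset (LandauFree H)).filter (fun i => a i ≠ 0)), edgeDist e j < 2 * (r : ℤ) - 1)
  · -- the support lies in the zone `r ≤ d ≤ 2r`
    obtain ⟨⟨i₀, hi₀, hdi₀⟩, ⟨j₀, hj₀, hdj₀⟩⟩ := hC
    have hzone : ∀ k ∈ ((Finset.univ : Finset (LandauFree H)).filter (fun i => a i ≠ 0)), (r : ℤ) ≤ edgeDist e k ∧ edgeDist e k ≤ 2 * (r : ℤ) := by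
      intro k hk
      have h1 := hdiam k i₀ ((hmemS k).1 hk) ((hmemS i₀).1 hi₀)
      have h2 := hdiam k j₀ ((hmemS k).1 hk) ((hmemS j₀).1 hj₀)
      rw [abs_le] at h1 h2
      have hdi₀' : (r : ℝ) + 1 < (edgeDist e i₀ : ℝ) := by exact_mod_cast hdi₀
      have hdj₀' : (edgeDist e j₀ : ℝ) < 2 * (r : ℝ) - 1 := by exact_mod_cast hdj₀
      constructor
      · have h3 : (r : ℝ) - 1 < (edgeDist e k : ℝ) := by linarith [h1.1]
        have h4 : (r : ℤ) - 1 < edgeDist e k := by exact_mod_cast h3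
        omega
      · have h3 : (edgeDist e k : ℝ) < 2 * (r : ℝ) + 1 := by linarith [h2.2]
        have h4 : edgeDist e k < 2 * (r : ℤ) + 1 := by exact_mod_cast h3
        omega
    have hind : ∑ i ∈ ((Finset.univ : Finset (LandauFree H)).filter (fun i => a i ≠ 0)), (if (r : ℤ) ≤ edgeDist e i ∧ edgeDist e i ≤ 2 * (r : ℤ) then u i ^ 2 else 0) = ∑ i ∈ ((Finset.univ : Finset (LandauFree H)).filter (fun i => a i ≠ 0)), u i ^ 2 :=
      Finset.sum_congr rfl fun i hi => if_pos (hzone i hi)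
    rw [hind]
    have hχ : ∀ i ∈ ((Finset.univ : Finset (LandauFree H)).filter (fun i => a i ≠ 0)), ∀ j ∈ ((Finset.univ : Finset (LandauFree H)).filter (fun i => a i ≠ 0)), |cutoff e r i - cutoff e r j| ≤ 2 / ((r : ℝ) - 2) := by
      intro i hi j hj
      refine (abs_cutoff_sub_le e hr i j).trans ?_
      exact div_le_div_of_nonneg_right (hdiam i j ((hmemS i).1 hi) ((hmemS j).1 hj)) hw.le
    refine (abs_commutator_sum_le a (cutoff e r) u ((Finset.univ : Finset (LandauFree H)).filter (fun i => a i ≠ 0)) hA hsupp habs hχ).trans ?_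
    have hsum0 : 0 ≤ ∑ i ∈ ((Finset.univ : Finset (LandauFree H)).filter (fun i => a i ≠ 0)), u i ^ 2 := Finset.sum_nonneg fun _ _ => sq_nonneg _
    have hcard' : (#((Finset.univ : Finset (LandauFree H)).filter (fun i => a i ≠ 0)) : ℝ) ≤ N := by exact_mod_cast hcard
    have h0 : 0 ≤ (2 / ((r : ℝ) - 2)) ^ 2 * A ^ 2 := mul_nonneg (sq_nonneg _) (sq_nonneg _)
    calc (2 / ((r : ℝ) - 2)) ^ 2 * A ^ 2 * #((Finset.univ : Finset (LandauFree H)).filter (fun i => a i ≠ 0)) * ∑ i ∈ ((Finset.univ : Finset (LandauFree H)).filter (fun i => a i ≠ 0)), u i ^ 2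
        = ((2 / ((r : ℝ) - 2)) ^ 2 * A ^ 2) * (#((Finset.univ : Finset (LandauFree H)).filter (fun i => a i ≠ 0)) * ∑ i ∈ ((Finset.univ : Finset (LandauFree H)).filter (fun i => a i ≠ 0)), u i ^ 2) := by ring
      _ ≤ ((2 / ((r : ℝ) - 2)) ^ 2 * A ^ 2) * (N * ∑ i ∈ ((Finset.univ : Finset (LandauFree H)).filter (fun i => a i ≠ 0)), u i ^ 2) :=
          mul_le_mul_of_nonneg_left (mul_le_mul_of_nonneg_right hcard' hsum0) h0
      _ = (2 / ((r : ℝ) - 2)) ^ 2 * A ^ 2 * N * ∑ i ∈ ((Finset.univ : Finset (LandauFree H)).filter (fun i => a i ≠ 0)), u i ^ 2 := by ring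
  · -- the cutoff is constant on the support: the commutator vanishes
    have hconst : ∀ i ∈ ((Finset.univ : Finset (LandauFree H)).filter (fun i => a i ≠ 0)), ∀ j ∈ ((Finset.univ : Finset (LandauFree H)).filter (fun i => a i ≠ 0)), |cutoff e r i - cutoff e r j| ≤ 0 := by
      rw [not_and_or] at hC
      rcases hC with hlo | hhi
      · push Not at hlo
        intro i hi j hj
        rw [cutoff_eq_zero_of_le e hr (hlo i hi), cutoff_eq_zero_of_le e hr (hlo j hj), sub_self, abs_zero]
      · push Not at hhi
        intro i hi j hj
        rw [cutoff_eq_one_of_ge e hr (hhi i hi), cutoff_eq_one_of_ge e hr (hhi j hj), sub_self, abs_zero]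
    have h := abs_commutator_sum_le a (cutoff e r) u ((Finset.univ : Finset (LandauFree H)).filter (fun i => a i ≠ 0)) hA hsupp habs hconst
    have hz : (0 : ℝ) ^ 2 * A ^ 2 * #((Finset.univ : Finset (LandauFree H)).filter (fun i => a i ≠ 0)) * ∑ i ∈ ((Finset.univ : Finset (LandauFree H)).filter (fun i => a i ≠ 0)), u i ^ 2 = 0 := by ring
    rw [hz] at h
    exact h.trans hRHS0

end Summit.QuantumFields.YangMills.Theorems.AllWindowsColdBoxBoxHighLine

end
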